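import Summits.QuantumFields.YangMills.Theorems.BalabanUVNodesN22AtRecordOfTermDataTableGermsRoad1LocatedRadiiContinuedTermSectors
import Summits.QuantumFields.YangMills.Theorems.BalabanUVNodesN22W1RelCentredSectorOfWindowDilated

/-!
# BalabanUVNodes ∕ node N22 = NE9 — THE ROAD-1 SOCKET AT def-W1's WINDOW-DILATED MEMBERS (the two halves of this lane meet): module J81c (ROAD-1 socket of record at the continued
# terms `TermData214.continuedTF`) with the sector FIXED to the relative sector `{z | ∃ t ∈ ]0,γ], |z − t| < c_A·t}` and the continued-term letters `hTh hT226 hTq` DISCHARGED from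
# the WINDOW-DILATED MEMBER statements on `ball 1 ρ_b` — holomorphy `hMdiff`, the (2.26) weight `hMbd` and the centred bound `hMcen` of `b ↦ (𝔇 K).memberTF (χu K) (χcu K) (𝒲 K)
# (𝒪 K) t k Z s b old φ` at every base point `t ∈ ]0,γ]` — by this lane's g7 module J1 `…N22W1RelCentredSectorOfWindowDilated` (members ⇒ sector clauses) and def-W1's LAW-FREE
# base-point freeness `continuedTF_eq_memberTF_of_mem`; the member statements are exactly the `hMlast ∕ hMcen` binders of the g6–g7 relative-disc road, whose producers from located
# primitive inputs are modules J6 ∕ J7b (`…MembersOfDatumBound ∕ Centred`) and node N10's `B13Term214WindowDilated` §4 ∕ `B13Bound226Centred`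

Cell `pub-ymgap`, HUMAN RULING D-0062 (Track A), R134 seat `pub-ymgap-dag-n22-c` (strategy s1: «the history-Lipschitz estimate (2.40)–(2.41) p. 21 of [II] on the W1 object»), generation
20, module J81m.  THEOREMS ONLY (no `def`, no `sorry`, standard axioms); `--kind proof --supports stmt-QuantumFields-27366 --as helper` (K3⁸ `SpineGivenEndpointR13SepCoPHV`), COUNT-NEUTRAL.
Imports this lane's module J81c `…N22AtRecordOfTermDataTableGermsRoad1LocatedRadiiContinuedTermSectors` and g7 module J1 `…N22W1RelCentredSectorOfWindowDilated` (through it R3 `…RelCentredSector`).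
Nothing re-declared; consumed BY NAME.

WHY.  After J81c every last-coupling input of the ROAD-1 bill at def-W1's term data was a per-term letter of `z ↦ continuedTF … γ k Z s z old φ` on the sectors `O K`.  By definition
(`Node00/HistoryTermDatum214WindowDilated` §4) `continuedTF … γ k Z s u old φ = memberTF … γ k Z s (γ∕u) old φ`, and LAW-FREE base-point freeness (`continuedTF_eq_memberTF_of_mem`)
reads it from ANY base point: `= memberTF … t k Z s (t∕u) old φ` for every `t ∈ ]0,γ]`, every `u`.  On the relative sector of aperture `c_A` (`0 < c_S < c_A < 1`, `c_A∕(1−c_A) < ρ_b`)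
every point `u` lies in a relative disc `|u − t| < c_A t`, on which `t∕u ∈ ball 1 ρ_b`; so g7's J1 transports the three MEMBER statements on `ball 1 ρ_b` — `hMdiff` (holomorphy in
the dilation parameter), `hMbd` (the (2.26) weight `weight·e^{a₅|Z|}`), `hMcen` (the centred bound `‖member − T₀‖ ≤ M_v·t²·weight·e^{a₅|Z|}` about the z-free centre `T₀`, factor `t²` =
the base point squared) — to the sector: `differentiableOn_relSector_of_members` (hTh), `norm_le_relSector_of_members` (hT226), `norm_sub_le_sq_relSector_of_members` (hTq with
`C_q := (1−c_A)⁻²·M_v`, since `(1−c_A)t ≤ ‖u‖`).  The sector is open (`isOpen_relSector`) and contains the discs `closedBall t (c_S·t)` (`closedBall_subset_relSector`, `c_S < c_A`).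
THIS FILE instantiates J81c there.  What stays displayed of the last coupling: the MEMBER statements `hMdiff hMbd hMcen` + the centre's weight `hT₀` — the `hMlast ∕ hMcen` binders
of modules J2∕J6∕J7b (g6–g7) in def-W1's `memberTF` currency, i.e. [I] p. 267's scaling read at a complex dilation parameter: (2.14)'s X-integral with precision `b²A`, source `bΓ`,
Wilson part `b²W_t`, boxes FROZEN AT THE REAL BASE POINT `t` (no threshold continued — cf. module J80A).
* §1 ★★★ socket `n22At_u3OfRecord₁₃_of_termDataTableGermsLocatedRadiiDilatedMembersRoad1Max` — binder diff vs J81c: `O hO hballS` OUT (sector fixed; `c_S < c_A <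
  1`, `c_A∕(1−c_A) < ρ_b` IN), `C_q hCq ↦ M_v hMv` (`C_q := (1−c_A)⁻²M_v` inside `hBqv`), `hTh hT226 hTq ↦ hMdiff hMbd hMcen` (member statements on `ball 1 ρ_b` at every base point).
THE N22 ROAD-1 BILL AT def-W1's TERM DATA AFTER J81m: (1.21) `hlim`; W1-20's law `hloc`; NODE A's located (2.26) records `hι` (N10 per-slice, τ-radii margin) and
`hloc18` (N18 per-step); def-W1's laws (`UnscaledFieldLawOn`, `ReadsBy` + atom regularity, `MapsToTables … univ` on windows `W ⊇ sp`, `𝒲` measurable); the WINDOW-DILATED MEMBER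
statements per term and base point: `hMdiff`, `hMbd`, centre `T₀` with `hT₀`, centred `hMcen` (UNPRINTED as estimates: [I] p. 263 «(or analytic)», p. 267 «B = g_kB′», (2.13) p. 268
«vanishes at g_k = 0»; the second-order letter is the producer's centred (2.15) — lens T21, desk ME #17); chart DATA; numerics (+ `0 < c_S < c_A < 1`, `c_A∕(1−c_A) < ρ_b`,
`0 ≤ M_v`, `hBqv` at `C_q = (1−c_A)⁻²M_v`); ROAD-1 rows (`B_q·γ∕c_S ≤ ℓ₁`, `0 ≤ ℓ₁`, `0 ≤ ω₁`, `ω₁ ≤ μ`, `4M_b c_w∕ϱ ≤ μ`, `μ ≤ ℓ.ω`, `ℓ.κ ≤ δ₁`, `hrow`); NO node-N18 rate letter.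

HONEST FRAMING (binding).  Count-neutral INSTANCE of module J81c BY NAME with g7's three member-to-sector transports and def-W1's base-point freeness; the member statements, the
located records, the laws, the chart data, the numerics and every other binder are DISPLAYED HYPOTHESES; NO estimate of Bałaban's is proved or asserted; nothing of the record is
constructed or claimed to meet the displayed inputs.  N18, N10 and N22 are NOT discharged (typed 28∕28; count 7∕27 per dag-lead TABLE — N22 unchanged); K3⁸ OPEN and NOT claimed;
NE9 ∕ NE5 NOT IN PRINT for d = 4; no count claim; one finite 𝕋⁴ programme at fixed ε — R4 closes the CONDITIONAL rung `BalabanLadder.UV` only; NOTHING about the continuum limit, ℝ⁴,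
infinite volume, OS axioms, a mass gap or the Clay problem is proved or claimed.  References (TYPES only): [II] = Bałaban, CMP 116 (1988) (1.41) p. 11, (2.13)–(2.15) pp. 14–15,
(2.26) p. 17, Lemma 3 (2.38) p. 20, (2.39)–(2.41) p. 21; [I] = CMP 109 (1987) §1 p. 263, (1.17)–(1.18) p. 263, (2.9)–(2.13) pp. 266–268; Kotecký–Preiss, CMP 103 (1986) Thm p. 492; King,
CMP 102 (1986) Lemma 4.5 (4.38).
-/

noncomputable section

open Set Metric
open scoped BigOperators

namespace YMDAG.N22.KernelFading

open Literature.MathematicalPhysics.QuantumFieldTheory.Balaban1983to89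
open Literature.MathematicalPhysics.QuantumFieldTheory.Balaban1983to89.T4Continuum (T4Family ULoop)
open Literature.MathematicalPhysics.QuantumFieldTheory.Balaban1983to89.T4OutputRate (Window NE9)
open Literature.MathematicalPhysics.QuantumFieldTheory.Balaban1983to89.TreeLengthTorus (TPt TDom tsys torusTreeLen)
open Literature.MathematicalPhysics.QuantumFieldTheory.Balaban1983to89.B9Thm37GlueTorus (tdist1)
open Literature.MathematicalPhysics.QuantumFieldTheory.Balaban1983to89.B12TreeDecay (K₀ kappa₀)
open Literature.MathematicalPhysics.QuantumFieldTheory.Balaban1983to89.B12Decay510 (delta1)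
open Literature.MathematicalPhysics.QuantumFieldTheory.Balaban1983to89.B12Decay510Window (K₁)
open Literature.MathematicalPhysics.QuantumFieldTheory.Balaban1983to89.B12Decay510Torus (distCT nearT)
open Literature.MathematicalPhysics.QuantumFieldTheory.Balaban1983to89.B13Lemma3TorusData (TBond)
open Literature.MathematicalPhysics.QuantumFieldTheory.Balaban1983to89.B13Lemma3TorusTerms (terms weight)
open Literature.MathematicalPhysics.QuantumFieldTheory.Balaban1983to89.B13Lemma3TorusSocket (Lemma3Numerics)
open Literature.MathematicalPhysics.QuantumFieldTheory.Balaban1983to89.B13OlderTermsTableGerms (Pot cv ρ)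
open Literature.MathematicalPhysics.QuantumFieldTheory.Balaban1983to89.Node00 (Stage13Params Stage13HParams U3Letters₁₁ MatA)
open Literature.MathematicalPhysics.QuantumFieldTheory.Balaban1983to89.Node00.Sect2 (domSys domCount CPair)
open Literature.MathematicalPhysics.QuantumFieldTheory.Balaban1983to89.Node00.W1
open Literature.MathematicalPhysics.QuantumFieldTheory.Balaban1983to89.Node00.LocalizedSum17 (ReadingMaps Localizes17OfRecord₁₃)
open Literature.MathematicalPhysics.QuantumFieldTheory.Balaban1983to89.Node00.U3OfKernels (histPrefix objectsOfRecord₁₃)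
open Literature.MathematicalPhysics.QuantumFieldTheory.Balaban1983to89.Node00.U3KernelLetters (PolLimitsExistOfRecord₁₃)
open YMDAG.UVSplit (N22At u3OfRecord₁₃ RateReading₁₃CoPH rateCarriersOfRecord₁₃CoPH)
open YMDAG.N22.AtKernels (n22At_u3OfRecord₁₃_objectsOfRecord₁₃_iff)
open YMDAG.N10 (termReading226_tableGerms_of_inputs226Holo_tauRadii)
open Summit.QuantumFields.YangMills.BalabanUVNodes.N18HLayerW1TermInputs226Chain (recAdmissible_Gn_of_inputs226Holo stepGen_Gn_of_inputs226Holo)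
open YMDAG.N18.W1Reading (hLayer_runTowers_toClusterTower_of_stepGen)
open YMDAG.N22.AtRecordOfPrintedSlots (differentiableOn_E_comp_of_printedSlots ball_mem_sp_of_spaceClause)

open YMDAG.N10 (lastCouplingSectors_ofTerms_of_termSectors)
open YMDAG.N22.TermRecursion (genT1last_of_lastSectorHolo)
open Literature.MathematicalPhysics.QuantumFieldTheory.Balaban1983to89.B13Resummation (locE_congr)

open YMDAG.N22.W1 (isOpen_relSector closedBall_subset_relSector differentiableOn_relSector_of_members norm_le_relSector_of_members
  norm_sub_le_sq_relSector_of_members)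

open scoped Matrix Matrix.Norms.L2Operator

variable (F : T4Family) (N : ℕ) [NeZero N] {𝔸 : Type} [NormedRing 𝔸] [NormedAlgebra ℂ 𝔸]

/-! ## §1 ★★★ The kernel-face socket at def-W1's WINDOW-DILATED MEMBERS: the continued-term letters on the relative sector read from the member statements on `ball 1 ρ_b` -/

open Classical Finset in
/-- ★★★ **THE ROAD-1 KERNEL-FACE SOCKET AT def-W1's WINDOW-DILATED MEMBERS** — module J81c at the relative sector of aperture `c_A` with `hTh hT226 hTq` discharged from the member
statements `hMdiff hMbd hMcen` on `ball 1 ρ_b` (g7 J1's transports + `continuedTF_eq_memberTF_of_mem`), `C_q := (1−c_A)⁻²·M_v` ⟹ **`N22At (u3OfRecord₁₃ θ (objectsOfRecord₁₃ F N θ ℓ) k)`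
for EVERY run length `k`**; NO node-N18 rate letter.  LOCATED (hypothesis form); N22 NOT discharged. [folklore] -/
theorem n22At_u3OfRecord₁₃_of_termDataTableGermsLocatedRadiiDilatedMembersRoad1Max (θ : Stage13Params F N) (ℓ : U3Letters₁₁) (hs : ℓ.Signs) (hγ : 0 < θ.γ) (hlim : PolLimitsExistOfRecord₁₃ F N θ)
    (m' : ℕ) (M : ℕ) [NeZero M] (hM : M = F.L ^ m')
    {c₀ : B13.Consts} {L : ℕ} [NeZero L] (𝔇 : (K : ℕ) → TermData214 c₀ (F.P K) 𝔸 M L) (emb : ReadingMaps F (MatA N) 𝔸)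
    (hloc : Localizes17OfRecord₁₃ F N θ (fun K => truncRun K (toClusterTower (𝔇 K).Gn)) emb)
    (sp : (K j : ℕ) → (domSys (F.P K) M j).Dom → Set (CPair (F.P K) 𝔸))
    (hsp : ∀ (K j : ℕ) (Y : (domSys (F.P K) M j).Dom), IsOpen (sp K j Y))
    {κ δ₀ B₃ r ℓ₁ R E₀ ϱ Mb cw ω₁ μ r₁ cS Bq : ℝ} {aw : ℕ → ℕ → ℕ → ℝ}
    (hκ₀ : kappa₀ (4 * 2 ^ 4) (2 * 4) ≤ κ / 2) (hδ₀ : 0 < δ₀) (hB₃ : 0 ≤ B₃) (hr : 0 < r) (hκE : κ ≤ r₁) (hE₀ : 0 ≤ E₀)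
    (big : (K j : ℕ) → (domSys (F.P K) M j).Dom → Set (CPair (F.P K) 𝔸))
    (hbigo : ∀ (K k : ℕ) (Z : (domSys (F.P K) M (k + 1)).Dom), IsOpen (big K (k + 1) Z))
    (hrestr : ∀ (K k : ℕ), SpRestr (sp K (k + 1))) (hbig : ∀ (K k : ℕ) (Z : (domSys (F.P K) M (k + 1)).Dom), sp K (k + 1) Z ⊆ big K (k + 1) Z)
    (c : B13.Consts) (hL : 8 ≤ c.L) (hLc : c.L = L) (hκ₁ : 1 ≤ c.κ₁) (hα₆ : c.α₆ ≠ 0) {a a₂ a₂' a₅ Aabs : ℝ} (hN : Lemma3Numerics c M ((c.L : ℝ) / 2) a a₂ a₂' a₅ Aabs)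
    {D : ℕ → Set ℂ}
    (hloc18 : ∀ (K k : ℕ), ∀ s ∈ D K, ∀ old : OlderTerms (F.P K) 𝔸 M k,
      (∀ (j : Fin (k + 1)) (Y : (domSys (F.P K) M j).Dom), ∀ ψ ∈ sp K j Y, ‖old j Y ψ‖ ≤ E₀ * Real.exp (-(r₁ * (domSys (F.P K) M j).dj Y))) →
      (∀ (j : Fin (k + 1)) (Y : (domSys (F.P K) M j).Dom), AnalyticOnNhd ℂ (old j Y) (sp K j Y)) →
      ∀ (Z : (domSys (F.P K) M (k + 1)).Dom), ∀ t ∈ terms L M Z, ∀ φ₁ ∈ big K (k + 1) Z, ∃ ι : (𝔇 K k).Inputs226Holo c Z t s old φ₁ a a₅,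
        (∀ φ ∈ big K (k + 1) Z, ∀ i j, DifferentiableOn ℂ (fun σ => (𝔇 K k).A Z t φ σ i j) {σ | ∀ j, σ j ∈ ι.Uσ}) ∧
        (∀ φ ∈ big K (k + 1) Z, ∀ i j, DifferentiableOn ℂ (fun σ => ((𝔇 K k).𝒦 Z t).G2 σ ((𝔇 K k).uOf Z t φ) i j) {σ | ∀ j, σ j ∈ ι.Uσ}) ∧
        (∀ σ : TPt (F.P K).d (domCount (F.P K) M (k + 1)) → ℂ, (∀ j, σ j ∈ ι.Uσ) → ∀ i j, DifferentiableOn ℂ (fun φ => (𝔇 K k).A Z t φ σ i j) (big K (k + 1) Z)) ∧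
        (∀ σ : TPt (F.P K).d (domCount (F.P K) M (k + 1)) → ℂ, (∀ j, σ j ∈ ι.Uσ) →
          ∀ i j, DifferentiableOn ℂ (fun φ => ((𝔇 K k).𝒦 Z t).G2 σ ((𝔇 K k).uOf Z t φ) i j) (big K (k + 1) Z)) ∧
        (∀ Y B, DifferentiableOn ℂ (fun φ => (𝔇 K k).𝒱 Z t s old φ Y B) (big K (k + 1) Z)) ∧
        (∀ φ ∈ big K (k + 1) Z, ∀ Y, Measurable ((𝔇 K k).𝒱 Z t s old φ Y)) ∧
        (∀ φ ∈ big K (k + 1) Z, ∀ σ : TPt (F.P K).d (domCount (F.P K) M (k + 1)) → ℂ, (∀ j, σ j ∈ ι.Uσ) → ((𝔇 K k).A Z t φ σ).IsSymm) ∧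
        (∀ φ ∈ big K (k + 1) Z, ∀ σ : TPt (F.P K).d (domCount (F.P K) M (k + 1)) → ℂ, (∀ j, σ j ∈ ι.Uσ) → (((𝔇 K k).A Z t φ σ).map Complex.re).PosDef) ∧
        (∀ φ ∈ big K (k + 1) Z, ∀ τ : TDom (F.P K).d (L * domCount (F.P K) M (k + 1)) → ℂ, (∀ Y, τ Y ∈ ι.Uτ Y) →
          ∀ B, ∑ Y ∈ t.1, ‖τ Y‖ * ‖(𝔇 K k).𝒱 Z t s old φ Y B‖ ≤ ι.a₂₀ / 2 * (B ⬝ᵥ B) + ι.w) ∧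
        (∀ φ ∈ big K (k + 1) Z, ∀ σ : TPt (F.P K).d (domCount (F.P K) M (k + 1)) → ℂ, (∀ j, σ j ∈ ι.Uσ) → ∀ b j, ‖((𝔇 K k).𝒦 Z t).G2 σ ((𝔇 K k).uOf Z t φ) b j‖ ≤
            ι.KG * Real.exp (-(ι.kap * tdist1 (𝔇 K k).Nf (((𝔇 K k).𝒦 Z t).locΛ b) (((𝔇 K k).𝒦 Z t).locN j)))) ∧
        (∀ φ ∈ big K (k + 1) Z, ∀ σ : TPt (F.P K).d (domCount (F.P K) M (k + 1)) → ℂ, (∀ j, σ j ∈ ι.Uσ) → ∀ b b', ‖((𝔇 K k).A Z t φ σ)⁻¹ b b'‖ ≤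
            ι.KCs * Real.exp (-(ι.kap * tdist1 (𝔇 K k).Nf (((𝔇 K k).𝒦 Z t).locΛ b) (((𝔇 K k).𝒦 Z t).locΛ b')))) ∧
        (∀ φ ∈ big K (k + 1) Z, ∀ σ : TPt (F.P K).d (domCount (F.P K) M (k + 1)) → ℂ, (∀ j, σ j ∈ ι.Uσ) →
          ∀ b j, ‖(((𝔇 K k).𝒦 Z t).G2 σ ((𝔇 K k).uOf Z t φ) - ((𝔇 K k).𝒦 Z t).Γ₀.map (algebraMap ℝ ℂ)) b j‖ ≤
            ι.θΓ * Real.exp (-(ι.kap * tdist1 (𝔇 K k).Nf (((𝔇 K k).𝒦 Z t).locΛ b) (((𝔇 K k).𝒦 Z t).locN j)))) ∧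
        (∀ φ ∈ big K (k + 1) Z, ∀ σ : TPt (F.P K).d (domCount (F.P K) M (k + 1)) → ℂ, (∀ j, σ j ∈ ι.Uσ) →
          ∀ b b', ‖(((𝔇 K k).A Z t φ σ)⁻¹ - ((𝔇 K k).𝒦 Z t).C.map (algebraMap ℝ ℂ)) b b'‖ ≤
            ι.θC * Real.exp (-(ι.kap * tdist1 (𝔇 K k).Nf (((𝔇 K k).𝒦 Z t).locΛ b) (((𝔇 K k).𝒦 Z t).locΛ b')))) ∧
        (∀ φ ∈ big K (k + 1) Z, ∀ σ : TPt (F.P K).d (domCount (F.P K) M (k + 1)) → ℂ, (∀ j, σ j ∈ ι.Uσ) →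
          ∀ b b', ‖((𝔇 K k).A Z t φ σ - ((𝔇 K k).𝒦 Z t).C⁻¹.map (algebraMap ℝ ℂ)) b b'‖ ≤
            ι.θE * Real.exp (-(ι.kap * tdist1 (𝔇 K k).Nf (((𝔇 K k).𝒦 Z t).locΛ b) (((𝔇 K k).𝒦 Z t).locΛ b')))))
    (hD : ∀ K, ∀ t ∈ Ioc (0 : ℝ) θ.γ, ((t : ℝ) : ℂ) ∈ D K)
    {S : ℕ → ℕ → Type} [∀ K k, MeasurableSpace (S K k)] [∀ K k, TopologicalSpace (S K k)] [∀ K k, OpensMeasurableSpace (S K k)]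
    (χu χcu : (K k : ℕ) → (𝔇 K k).UnscaledChi) (𝒲 : (K k : ℕ) → (𝔇 K k).UnscaledWilson) (𝒪 : (K k : ℕ) → (𝔇 K k).UnscaledOlder)
    (Rd : (K k : ℕ) → (Z : (domSys (F.P K) M (k + 1)).Dom) → (t : TermLabel (F.P K) M k L) → (𝔇 K k).ReadingAtoms Z t (S K k))
    (W : (K k : ℕ) → (domSys (F.P K) M (k + 1)).Dom → TermLabel (F.P K) M k L → Set (CPair (F.P K) 𝔸))
    (hlaw : ∀ K, (𝔇 K).UnscaledFieldLawOn (χu K) (χcu K) (𝒲 K) (𝒪 K) θ.γ) (hread : ∀ K k, (𝔇 K k).ReadsBy (𝒪 K k) (Rd K k))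
    (hmaps : ∀ (K k : ℕ) (Z : (domSys (F.P K) M (k + 1)).Dom) (t : TermLabel (F.P K) M k L), (Rd K k Z t).MapsToTables (sp K) (W K k Z t) univ)
    (hW : ∀ (K k : ℕ) (X Z : (domSys (F.P K) M (k + 1)).Dom), Subtype.val Z ⊆ Subtype.val X → ∀ s ∈ terms L M Z, sp K (k + 1) X ⊆ W K k Z s)
    (hcont : ∀ (K k : ℕ) (Z : (domSys (F.P K) M (k + 1)).Dom) (t : TermLabel (F.P K) M k L), (Rd K k Z t).CfgContinuous)
    (hjc : ∀ (K k : ℕ) (Z : (domSys (F.P K) M (k + 1)).Dom) (t : TermLabel (F.P K) M k L), (Rd K k Z t).CfgJointContinuous)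
    {Ck mk : ℝ} (hK : ∀ (K k : ℕ) (Z : (domSys (F.P K) M (k + 1)).Dom) (t : TermLabel (F.P K) M k L), (Rd K k Z t).KernelBounded Ck)
    (hμ : ∀ (K k : ℕ) (Z : (domSys (F.P K) M (k + 1)).Dom) (t : TermLabel (F.P K) M k L), (Rd K k Z t).FiniteMass mk) (hCk : 0 ≤ Ck) (hmk : 0 ≤ mk)
    (hWm : ∀ (K k : ℕ) (Z : (domSys (F.P K) M (k + 1)).Dom) (t : TermLabel (F.P K) M k L) (φ : CPair (F.P K) 𝔸) (Y : TDom (F.P K).d (L * domCount (F.P K) M (k + 1))),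
      Measurable fun B : ((𝔇 K k).𝒦 Z t).Λ → ℝ => 𝒲 K k Z t φ Y B)
    {b : ℝ} (hb : 0 < b) (hbaw : ∀ K k j, b ≤ aw K k j)
    (hι : ∀ (K k : ℕ), ∀ t ∈ Ioc (0 : ℝ) θ.γ, ∀ (X : (domSys (F.P K) M (k + 1)).Dom), ∀ φ ∈ sp K (k + 1) X,
      ∀ Z : (domSys (F.P K) M (k + 1)).Dom, Subtype.val Z ⊆ Subtype.val X → ∀ s ∈ terms L M Z,
        ∃ old₀ ∈ AdmHist (sp K) E₀ r₁ k, ∃ ι : (𝔇 K k).Inputs226Holo c Z s ((t : ℝ) : ℂ) old₀ φ a a₅, ∃ w₀ : ℝ,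
          (∀ τ : TDom (F.P K).d (L * domCount (F.P K) M (k + 1)) → ℂ, (∀ Y, τ Y ∈ ι.Uτ Y) → ∀ B : ((𝔇 K k).𝒦 Z s).Λ → ℝ,
            ∑ Y ∈ s.1, ‖τ Y‖ * ‖(𝔇 K k).𝒱 Z s ((t : ℝ) : ℂ) old₀ φ Y B‖ ≤ ι.a₂₀ / 2 * (B ⬝ᵥ B) + w₀) ∧
          w₀ + (∑ Y ∈ s.1, ((B13Bound143.invTau c ((tsys (F.P K).d (L * domCount (F.P K) M (k + 1))).dj Y))⁻¹ + (𝔇 K k).r + 2)) *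
            ((∑ _j : Fin (k + 1), ∑ _X : (domSys (F.P K) M _j).Dom, Ck) * mk * (E₀ + b⁻¹ * R)) ≤ ι.w)
    (hA0 : 0 ≤ c.C3act * c.ε₁) (hr₁ : 0 ≤ r₁) (hrate : r₁ + 2 * (64 * Real.log 162) + 2 ≤ (1 - 8 * c.δ) * ((c.L : ℝ) / 2) * c.κ)
    (hKP : c.C3act * c.ε₁ * Real.exp (5 * r₁ + 1) * K₀ 64 8 * 9 * 64 < 1) (hrenew : Real.exp 1 * 9 * 64 * K₀ 64 8 ^ 2 * (c.C3act * c.ε₁) ≤ Mb)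
    (hrenewE : Real.exp 1 * 9 * 64 * K₀ 64 8 ^ 2 * (c.C3act * c.ε₁) ≤ E₀)
    (hawcw : ∀ K k j, aw K k j ≤ cw) (hawω : ∀ K k j, j ≤ k → aw K k j ≤ cw * ω₁ ^ (k - j)) (hϱ : 0 < ϱ) (hR : cw * E₀ + ϱ < R)
    {cA ρb Mv : ℝ} (hcS : 0 < cS) (hcSA : cS < cA) (hcA1 : cA < 1) (hρb : cA / (1 - cA) < ρb) (hBq : 0 ≤ Bq)
    (hsmall2 : 2 * (c.C3act * c.ε₁) * Real.exp (5 * r₁ + 1) * K₀ 64 8 * 9 * 64 ≤ 1)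
    (T₀ : (K k : ℕ) → (domSys (F.P K) M (k + 1)).Dom → TermLabel (F.P K) M k L → OlderTerms (F.P K) 𝔸 M k → CPair (F.P K) 𝔸 → ℂ) (hMv : 0 ≤ Mv)
    (hBqv : 2 * (Real.exp 1 * 9 * 64 * K₀ 64 8 ^ 2 * (2 * (c.C3act * c.ε₁))) * ((1 - cA)⁻¹ ^ 2 * Mv) * (1 + cS) ^ 2 ≤ Bq)
    (hMdiff : ∀ (K k : ℕ) (old : OlderTerms (F.P K) 𝔸 M k), old ∈ AdmHist (sp K) E₀ r₁ k ∧ old 0 = 0 → ∀ (X : (domSys (F.P K) M (k + 1)).Dom), ∀ φ ∈ sp K (k + 1) X,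
      ∀ Z : (domSys (F.P K) M (k + 1)).Dom, Subtype.val Z ⊆ Subtype.val X → ∀ s ∈ terms L M Z, ∀ t ∈ Ioc (0 : ℝ) θ.γ,
        DifferentiableOn ℂ (fun b => (𝔇 K).memberTF (χu K) (χcu K) (𝒲 K) (𝒪 K) t k Z s b old φ) (ball (1 : ℂ) ρb))
    (hMbd : ∀ (K k : ℕ) (old : OlderTerms (F.P K) 𝔸 M k), old ∈ AdmHist (sp K) E₀ r₁ k ∧ old 0 = 0 → ∀ (X : (domSys (F.P K) M (k + 1)).Dom), ∀ φ ∈ sp K (k + 1) X,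
      ∀ Z : (domSys (F.P K) M (k + 1)).Dom, Subtype.val Z ⊆ Subtype.val X → ∀ s ∈ terms L M Z, ∀ t ∈ Ioc (0 : ℝ) θ.γ, ∀ b ∈ ball (1 : ℂ) ρb,
        ‖(𝔇 K).memberTF (χu K) (χcu K) (𝒲 K) (𝒪 K) t k Z s b old φ‖ ≤ weight L M c Z a s * Real.exp (a₅ * ((Z.1).card : ℝ)))
    (hT₀ : ∀ (K k : ℕ) (old : OlderTerms (F.P K) 𝔸 M k), old ∈ AdmHist (sp K) E₀ r₁ k ∧ old 0 = 0 → ∀ (X : (domSys (F.P K) M (k + 1)).Dom), ∀ φ ∈ sp K (k + 1) X,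
      ∀ Z : (domSys (F.P K) M (k + 1)).Dom, Subtype.val Z ⊆ Subtype.val X → ∀ s ∈ terms L M Z, ‖T₀ K k Z s old φ‖ ≤ weight L M c Z a s * Real.exp (a₅ * ((Z.1).card : ℝ)))
    (hMcen : ∀ (K k : ℕ) (old : OlderTerms (F.P K) 𝔸 M k), old ∈ AdmHist (sp K) E₀ r₁ k ∧ old 0 = 0 → ∀ (X : (domSys (F.P K) M (k + 1)).Dom), ∀ φ ∈ sp K (k + 1) X,
      ∀ Z : (domSys (F.P K) M (k + 1)).Dom, Subtype.val Z ⊆ Subtype.val X → ∀ s ∈ terms L M Z, ∀ t ∈ Ioc (0 : ℝ) θ.γ, ∀ b ∈ ball (1 : ℂ) ρb,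
        ‖(𝔇 K).memberTF (χu K) (χcu K) (𝒲 K) (𝒪 K) t k Z s b old φ - T₀ K k Z s old φ‖ ≤ Mv * t ^ 2 * (weight L M c Z a s * Real.exp (a₅ * ((Z.1).card : ℝ))))
    (hlamq : Bq * θ.γ / cS ≤ ℓ₁) (hℓ₁ : 0 ≤ ℓ₁) (hω₁ : 0 ≤ ω₁)
    (Ec : ℕ → ℕ → Type*) [∀ K k, NormedAddCommGroup (Ec K k)] [∀ K k, NormedSpace ℂ (Ec K k)]
    (ι : letI := θ.instVβ₁; letI := θ.instVβ₂
      (K k : ℕ) → (domSys (F.P K) M (k + 1)).Dom → ((Fin (F.P K).d → Site (F.P K) (k + 1) → θ.Vβ) →L[ℝ] Ec K k))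
    (Φ : (K k : ℕ) → (domSys (F.P K) M (k + 1)).Dom → Ec K k → CPair (F.P K) 𝔸)
    (U : (K k : ℕ) → (domSys (F.P K) M (k + 1)).Dom → Set (Ec K k)) (hU : ∀ K k X, IsOpen (U K k X)) (hrU : ∀ K k X, ball (0 : Ec K k) r ⊆ U K k X)
    (hΦhol : ∀ (K k : ℕ) (X : (domSys (F.P K) M (k + 1)).Dom), DifferentiableOn ℂ (Φ K k X) (U K k X))
    (hΦemb : letI := θ.instVβ₁; letI := θ.instVβ₂
      ∀ (K k : ℕ) (X : (domSys (F.P K) M (k + 1)).Dom) (Bf : Fin (F.P K).d → Site (F.P K) (k + 1) → θ.Vβ),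
        Φ K k X (ι K k X Bf) = emb K k (fun l t => NormedSpace.exp (θ.ρ8 (Bf l t))))
    (hΦsp : ∀ (K k : ℕ) (X : (domSys (F.P K) M (k + 1)).Dom), ∀ z ∈ U K k X, ∀ Z : (domSys (F.P K) M (k + 1)).Dom, Z.1 ⊆ X.1 → Φ K k X z ∈ sp K (k + 1) Z)
    (w : (K k : ℕ) → (domSys (F.P K) M (k + 1)).Dom → Site (F.P K) (k + 1) → ℝ) (hw₀ : ∀ K k X t, 0 ≤ w K k X t)
    (hw : letI := θ.instVβ₁; letI := θ.instVβ₂; letI := θ.instιβ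
      ∀ (K k : ℕ) (X : (domSys (F.P K) M (k + 1)).Dom) (l : Fin (F.P K).d) (t : Site (F.P K) (k + 1)) (c : θ.ιβ),
        ‖ι K k X (Pi.single l (Pi.single t (θ.bV c)))‖ ≤ w K k X t)
    (htail : ∀ (K k : ℕ) (X : (domSys (F.P K) M (k + 1)).Dom) (t : Site (F.P K) (k + 1)),
      let e : Site (F.P K) (k + 1) → TPt 4 (domCount (F.P K) M (k + 1) * M) := fun x i => (ZMod.cast (x i) : ZMod (domCount (F.P K) M (k + 1) * M))
      w K k X t ≤ B₃ * Real.exp (-δ₀ * distCT (domCount (F.P K) M (k + 1)) M (e t) (nearT (M := M) (e t) X)))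
    (hω₁μ : ω₁ ≤ μ) (hCμ : 4 * Mb * cw / ϱ ≤ μ) (hμω : μ ≤ ℓ.ω) (hℓκ : ℓ.κ ≤ delta1 δ₀ κ ((M : ℝ) * 4))
    (hrow : 16 * B₃ ^ 2 / r ^ 2 * Real.exp (delta1 δ₀ κ ((M : ℝ) * 4) * ((M : ℝ) * 4) * 3) * K₀ (4 * 2 ^ 4) (2 * 4) * K₁ 4 (δ₀ / 2) * ℓ₁ ≤ ℓ.C₉ * ℓ.ω) (k : ℕ) :
    N22At (u3OfRecord₁₃ θ (objectsOfRecord₁₃ F N θ ℓ) k) :=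
  n22At_u3OfRecord₁₃_of_termDataTableGermsLocatedRadiiContinuedTermSectorsRoad1Max F N
    θ ℓ hs hγ hlim m' M hM 𝔇 emb hloc sp hsp hκ₀ hδ₀ hB₃ hr hκE hE₀ big hbigo hrestr hbig c hL hLc hκ₁ hα₆ hN hloc18 hD χu χcu 𝒲 𝒪 Rd W hlaw hread hmaps hW hcont hjc
    hK hμ hCk hmk hWm hb hbaw hι hA0 hr₁ hrate hKP hrenew hrenewE hawcw hawω hϱ hR
    (fun _ => {z : ℂ | ∃ t ∈ Ioc (0 : ℝ) θ.γ, dist z (t : ℂ) < cA * t}) (fun _ => isOpen_relSector θ.γ cA) hcS hBq (fun _ s hs => closedBall_subset_relSector hcSA hs) hsmall2 T₀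
    (by positivity) hBqv
    (fun K k old hold X φ hφ Z hZ s hs => differentiableOn_relSector_of_members (hcS.trans hcSA).le hcA1 hρb
      (m := fun t b => (𝔇 K).memberTF (χu K) (χcu K) (𝒲 K) (𝒪 K) t k Z s b old φ) (f := fun z => (𝔇 K).continuedTF (χu K) (χcu K) (𝒲 K) (𝒪 K) θ.γ k Z s z old φ)
      (hMdiff K k old hold X φ hφ Z hZ s hs) fun t ht u _ => TermData214.continuedTF_eq_memberTF_of_mem (𝔇 K) (χu K) (χcu K) (𝒲 K) (𝒪 K) k Z s old φ t ht u)
    (fun K k old hold X φ hφ Z hZ s hs => norm_le_relSector_of_members (hcS.trans hcSA).le hcA1 hρb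
      (m := fun t b => (𝔇 K).memberTF (χu K) (χcu K) (𝒲 K) (𝒪 K) t k Z s b old φ) (f := fun z => (𝔇 K).continuedTF (χu K) (χcu K) (𝒲 K) (𝒪 K) θ.γ k Z s z old φ)
      (hMbd K k old hold X φ hφ Z hZ s hs) fun t ht u _ => TermData214.continuedTF_eq_memberTF_of_mem (𝔇 K) (χu K) (χcu K) (𝒲 K) (𝒪 K) k Z s old φ t ht u)
    hT₀
    (fun K k old hold X φ hφ Z hZ s hs => norm_sub_le_sq_relSector_of_members (hcS.trans hcSA) hcA1 hρb
      (m := fun t b => (𝔇 K).memberTF (χu K) (χcu K) (𝒲 K) (𝒪 K) t k Z s b old φ) (f := fun z => (𝔇 K).continuedTF (χu K) (χcu K) (𝒲 K) (𝒪 K) θ.γ k Z s z old φ)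
      (hMcen K k old hold X φ hφ Z hZ s hs) fun t ht u _ => TermData214.continuedTF_eq_memberTF_of_mem (𝔇 K) (χu K) (χcu K) (𝒲 K) (𝒪 K) k Z s old φ t ht u)
    hlamq hℓ₁ hω₁ Ec ι Φ U hU hrU hΦhol hΦemb hΦsp w hw₀ hw htail hω₁μ hCμ hμω hℓκ hrow k

end YMDAG.N22.KernelFading

end
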